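import Summits.AtomisticToContinuum.Crystallization.Theorems.OverbindingBudgetMisfitRegistration

/-!
# NODE g79 rider «CompressedCut (F1′)» — the FIRST-SHELL SCALE FLOOR of a two-shell framed site

Route `OverbindingBudget` (Crystallization), docket stmt-AtomisticToContinuum-31280, decomp-a2c lens 4, generation 79.  Input (c) of the open leaf
`NearFieldSlack 12 (1/25)` of NODE g79 «CompressedCut» (memo NODE-g79 §5): at a `(ε, g)`-two-shell FRAMED site `i`, every other site `k` at depth `t`
inside the exhaustive radius — `dist (y k) (y i) ≤ (3/2 + g − t)·nn_i` — has own spacing `nn_k ≥ min t (1 − 2ε)·nn_i`: a site `j ≠ k` inside the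
exhaustive radius is matched, like `k`, to a pattern point, pattern points are `1`-separated and matched within `ε·nn_i`, so `dist (y k) (y j) ≥
(1 − 2ε)·nn_i` (and `≥ (1 − ε)·nn_i` for `j = i`, pattern points having norm `≥ 1`); a site outside it is `> t·nn_i` away by the triangle inequality.
At the record literals `(ε, g) = (3/50, 1/450)` and first-shell depth `t = 11/25`: a site within `53/50·nn_i` of `i` has `nn_k ≥ 11/25·nn_i > 2/5·nn_i`,
so NODE g79's `scaleWeight y i k ∈ {½, 1}` — first-shell repulsion is never attributed away from `i` (`not_le_two_fifths_of_firstShell`).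
Elementary (no potential, no lattice sums); tree only (`Framed`, the two-shell patterns, `nearestDist`).  0 sorry.
-/

namespace Summit.AtomisticToContinuum.Crystallization.Theorems.OverbindingBudgetAffineCompressedCutF1

open Literature.Geometry.DiscreteGeometry (nearestDist nearestDist_nonneg nearestDist_le_dist le_nearestDist fccTwoShellPattern hcpTwoShellPattern
  one_le_dist_of_mem_fccTwoShellPattern one_le_dist_of_mem_hcpTwoShellPattern norm_of_mem_fccTwoShellPattern norm_of_mem_hcpTwoShellPattern)
open Summit.AtomisticToContinuum.Crystallization.Theorems.OverbindingBudgetMisfitRegistration (Framed)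

variable {N : ℕ}

/-- Either two-shell pattern is `1`-separated. [Literature `one_le_dist_of_mem_fcc/hcpTwoShellPattern`] -/
private theorem one_le_dist_of_mem_twoShellPattern {P : Finset (EuclideanSpace ℝ (Fin 3))} (hP : P = fccTwoShellPattern ∨ P = hcpTwoShellPattern)
    {v w : EuclideanSpace ℝ (Fin 3)} (hv : v ∈ P) (hw : w ∈ P) (hvw : v ≠ w) : 1 ≤ dist v w := by
  rcases hP with rfl | rfl
  · exact one_le_dist_of_mem_fccTwoShellPattern hv hw hvw
  · exact one_le_dist_of_mem_hcpTwoShellPattern hv hw hvw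

/-- Points of either two-shell pattern have norm `≥ 1`. [Literature `norm_of_mem_fcc/hcpTwoShellPattern`] -/
private theorem one_le_norm_of_mem_twoShellPattern {P : Finset (EuclideanSpace ℝ (Fin 3))} (hP : P = fccTwoShellPattern ∨ P = hcpTwoShellPattern)
    {v : EuclideanSpace ℝ (Fin 3)} (hv : v ∈ P) : 1 ≤ ‖v‖ := by
  have h2 : (1 : ℝ) ≤ Real.sqrt 2 := Real.one_le_sqrt.mpr (by norm_num)
  rcases hP with rfl | rfl
  · rcases norm_of_mem_fccTwoShellPattern hv with h | h <;> rw [h]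
    exact h2
  · rcases norm_of_mem_hcpTwoShellPattern hv with h | h <;> rw [h]
    exact h2

/-- **(F1′) FIRST-SHELL SCALE FLOOR.**  At a two-shell framed site `i` (`0 ≤ ε`), a site `k ≠ i` at depth `t ≥ 0` inside the exhaustive radius,
`dist (y k) (y i) ≤ (3/2 + g − t)·nn_i`, has `nn_k ≥ min t (1 − 2ε)·nn_i`. [this file] -/
theorem firstShell_scale_floor {ε g t : ℝ} (hε : 0 ≤ ε) (ht : 0 ≤ t) {y : Fin N → EuclideanSpace ℝ (Fin 3)} (hy : Function.Injective y)
    {i k : Fin N} (hi : Framed ε g y i) (hki : k ≠ i) (hk : dist (y k) (y i) ≤ (3 / 2 + g - t) * nearestDist y i) :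
    min t (1 - 2 * ε) * nearestDist y i ≤ nearestDist y k := by
  obtain ⟨A, P, f, hP, hf, hinj, hex⟩ := hi
  set s := nearestDist y i with hs
  have hnn : 0 ≤ s := nearestDist_nonneg y i
  have htk : dist (y k) (y i) ≤ (3 / 2 + g) * s := hk.trans (by nlinarith)
  obtain ⟨v, hv, hfv⟩ := hex k hki htk
  have hvk : dist (y k) (y i + s • A v) ≤ ε * s := by have h := (hf v hv).2; rwa [hfv] at h
  have hmin_le : min t (1 - 2 * ε) * s ≤ (1 - 2 * ε) * s := mul_le_mul_of_nonneg_right (min_le_right _ _) hnn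
  have hmin_le' : min t (1 - 2 * ε) * s ≤ t * s := mul_le_mul_of_nonneg_right (min_le_left _ _) hnn
  refine le_nearestDist ⟨i, hki.symm⟩ fun j hj => ?_
  by_cases hji : j = i
  · subst hji
    -- `dist (y k) (y j) ≥ ‖s • A v‖ − ε s = s‖v‖ − ε s ≥ (1 − ε) s`
    have hc : dist (y j + s • A v) (y j) = s * ‖v‖ := by
      rw [dist_eq_norm, add_sub_cancel_left, norm_smul, Real.norm_of_nonneg hnn, A.norm_map]
    have htri := dist_triangle (y j + s • A v) (y k) (y j)
    rw [hc, dist_comm (y j + s • A v) (y k)] at htri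
    have h1 : s * 1 ≤ s * ‖v‖ := mul_le_mul_of_nonneg_left (one_le_norm_of_mem_twoShellPattern hP hv) hnn
    nlinarith [mul_nonneg hε hnn]
  · by_cases hjn : dist (y j) (y i) ≤ (3 / 2 + g) * s
    · obtain ⟨v', hv', hfv'⟩ := hex j hji hjn
      have hne : v ≠ v' := by
        rintro rfl
        exact hj (hy (hfv'.symm.trans hfv))
      have hvj : dist (y j) (y i + s • A v') ≤ ε * s := by have h := (hf v' hv').2; rwa [hfv'] at h
      have hc : dist (y i + s • A v) (y i + s • A v') = s * dist v v' := by
        rw [dist_add_left, dist_eq_norm, ← smul_sub, norm_smul, Real.norm_of_nonneg hnn, ← map_sub, A.norm_map, ← dist_eq_norm]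
      have htri := dist_triangle4 (y i + s • A v) (y k) (y j) (y i + s • A v')
      rw [hc, dist_comm (y i + s • A v) (y k)] at htri
      have h1 : s * 1 ≤ s * dist v v' := mul_le_mul_of_nonneg_left (one_le_dist_of_mem_twoShellPattern hP hv hv' hne) hnn
      linarith
    · -- `j` outside the exhaustive radius: `dist (y k) (y j) ≥ dist (y j) (y i) − dist (y k) (y i) > t s`
      have htri := dist_triangle (y j) (y k) (y i)
      rw [dist_comm (y j) (y k)] at htri
      push Not at hjn
      linarith

/-- **Record instance**: at `(ε, g) = (3/50, 1/450)` a site within `53/50·nn_i` of a framed site `i` (its first shell, matched within `3/50·nn_i` of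
pattern points at distance `nn_i`) has `nn_k ≥ 11/25·nn_i`. [this file] -/
theorem firstShell_scale_floor_record {y : Fin N → EuclideanSpace ℝ (Fin 3)} (hy : Function.Injective y) {i k : Fin N}
    (hi : Framed (3 / 50) (1 / 450) y i) (hki : k ≠ i) (hk : dist (y k) (y i) ≤ 53 / 50 * nearestDist y i) :
    11 / 25 * nearestDist y i ≤ nearestDist y k := by
  have h := firstShell_scale_floor (ε := 3 / 50) (g := 1 / 450) (t := 11 / 25) (by norm_num) (by norm_num) hy hi hki
    (hk.trans (mul_le_mul_of_nonneg_right (by norm_num) (nearestDist_nonneg y i)))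
  have e : min (11 / 25 : ℝ) (1 - 2 * (3 / 50)) = 11 / 25 := by norm_num
  rwa [e] at h

/-- Hence NODE g79's scale attribution never gives weight `0` to `i` for a first-shell pair: `¬ nn_k ≤ 2/5·nn_i` (given `nn_i > 0`). [this file] -/
theorem not_le_two_fifths_of_firstShell {y : Fin N → EuclideanSpace ℝ (Fin 3)} (hy : Function.Injective y) {i k : Fin N}
    (hi : Framed (3 / 50) (1 / 450) y i) (hki : k ≠ i) (hk : dist (y k) (y i) ≤ 53 / 50 * nearestDist y i) (hpos : 0 < nearestDist y i) :
    ¬ nearestDist y k ≤ 2 / 5 * nearestDist y i := by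
  have h := firstShell_scale_floor_record hy hi hki hk
  intro h'
  linarith

end Summit.AtomisticToContinuum.Crystallization.Theorems.OverbindingBudgetAffineCompressedCutF1
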